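import Literature.Uncategorized.OscillatoryJacobi
import Literature.Analysis.ODE.OscillatoryJacobi
import HarnessLib

/-!
# Discharge of `Literature.Uncategorized.OscillatoryJacobi` — MOVED (one-line consequence)

Topic `Literature/Uncategorized`; sibling proof file of `OscillatoryJacobi.lean` (which states the named fact
`Literature.Uncategorized.OscillatoryJacobi`, relocated there by the gate from a `FinalStateConjecture` route).
The Grönwall proof that used to live here moved VERBATIM to its topical home
`Literature/Analysis/ODE/OscillatoryJacobi.lean` (`Literature.Analysis.ODE.oscillatoryJacobi_bound`, librarian
refactor wi-38735, 2026-08-17); this file keeps the discharge record `OscillatoryJacobi_holds` as a one-line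
consequence so that the by-name census (`X_holds : X`) and existing imports are unaffected.
Everything here is **proved**; no definitions, no new facts.

* `OscillatoryJacobi_holds : OscillatoryJacobi`.

## References

Folklore (Grönwall's inequality; P. Hartman, *Ordinary Differential Equations* (1964), Ch. III §1;
`Mathlib.Analysis.ODE.Gronwall`).
-/

namespace Literature.Uncategorized

/-- **Discharge of the oscillatory Jacobi lemma** `OscillatoryJacobi`: verbatim the theorem
`Literature.Analysis.ODE.oscillatoryJacobi_bound` (topical home of the proof). New consumers should use that
theorem directly. [folklore] -/
theorem OscillatoryJacobi_holds : OscillatoryJacobi :=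
  Literature.Analysis.ODE.oscillatoryJacobi_bound

end Literature.Uncategorized
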